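import Mathlib.Analysis.Matrix.Spectrum
import Mathlib.LinearAlgebra.Matrix.Kronecker
import Mathlib.Topology.Instances.Matrix
import Mathlib.Topology.ContinuousMap.Weierstrass
import Mathlib.Topology.UniformSpace.UniformApproximation
import Mathlib.Analysis.SpecialFunctions.Log.NegMulLog
import Mathlib.Analysis.SpecialFunctions.Pow.Real
import Literature.Computability.AlgebraicComplexity.QuantumFunctionals
import HarnessLib

/-!
# Quantum functionals: proof of degeneration monotonicity (CVZ Thm. 3.19.4 = Lemma 3.20)

Topic: `Literature/Computability/AlgebraicComplexity`. This file discharges the named fact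
`ChristandlVranaZuiddam2023_degeneration_mono` of `QuantumFunctionals.lean` (the sibling
`QuantumFunctionalsProofs.lean` holds the unit-tensor normalisation `_unitTensor_holds`):
for `θ ∈ P([3])` and complex 3-tensors `s ⊵ t` (i.e. `t` in the Euclidean closure of the
`GL × GL × GL`-orbit of `s`), `F^θ(t) ≤ F^θ(s)`.

## The printed proof (Christandl–Vrana–Zuiddam, J. Amer. Math. Soc. 36 (2023), Lemma 3.20)

Take `g_i ∈ G = GL(V₁) × GL(V₂) × GL(V₃)` with `g_i · s → t`. For every `B ∈ G`,
`E_θ(s) = sup_C H_θ(C · s) ≥ lim_i H_θ(B g_i · s) = H_θ(B · t)` *by continuity of `H_θ`*; taking the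
supremum over `B` gives `E_θ(s) ≥ E_θ(t)`, hence `F_θ(s) ≥ F_θ(t)` (and `F_θ = F^θ` for `k = 3`,
Thm. 3.30, which is how `quantumFunctional` is set up in `QuantumFunctionals.lean`).

## What is proved here, and how

The only analytic input the source takes for granted is the continuity of
`t ↦ H_θ(t) = ∑_j θ(j) H(r_j(t))` on nonzero tensors, where `r_j(t)` is the spectrum of the
normalised `j`-th quantum marginal. We prove it without eigenvalue perturbation theory:
for a polynomial `p`, `∑_i p(λ_i(M)/T) = ∑_k p_k · Re Tr(M^k) / T^k` is manifestly continuous in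
the tensor (`trace_pow_eq_sum_eigenvalues_pow`, from the spectral theorem), and `-x log x` is a
uniform limit of polynomials on `[0, 1]` (Weierstrass, `exists_polynomial_near_of_continuousOn`),
so the entropy of the marginal spectrum is a uniform limit of continuous functions on `{t ≠ 0}`
(`continuousOn_sum_negMulLog_eigenvalues_div`). The rest is the printed argument:
`quantumEntropy_le_logQuantumFunctional_of_degeneratesTo` (the displayed inequality),
`logQuantumFunctional_le_of_degeneratesTo` (`E_θ(t) ≤ E_θ(s)`), and the exponentiated form
`ChristandlVranaZuiddam2023_degeneration_mono_holds`. On the way: the composition law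
`actTensor_actTensor` (`(A ⊗ B ⊗ C)·((A' ⊗ B' ⊗ C')·t) = (AA' ⊗ BB' ⊗ CC')·t`), continuity of
`actTensor`, `reducedDensityⱼ`, `tensorNormSq`, and stability of degeneration under the group
(`TensorDegeneratesTo.actTensor_right`) and at `0` (`TensorDegeneratesTo.eq_zero_of_zero`).

No new definitions; nothing here restates the fact.
-/

noncomputable section

open scoped BigOperators Matrix ComplexOrder Kronecker
open Real (negMulLog)
open _root_.Topology Filter Set

namespace Literature.Computability.AlgebraicComplexity

universe u

/-! ## Algebra and topology of the action `(A ⊗ B ⊗ C)·t` -/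

section Action

variable {K : Type*} [CommSemiring K] {ι κ μ ι' κ' μ' ι'' κ'' μ'' : Type*}
  [Fintype ι] [Fintype κ] [Fintype μ]

/-- `(A ⊗ B ⊗ C)·t` is the Kronecker product matrix `A ⊗ₖ (B ⊗ₖ C)` applied to `t` read as a vector
indexed by `ι × κ × μ`. [folklore] -/
theorem actTensor_eq_kronecker_mulVec (A : Matrix ι' ι K) (B : Matrix κ' κ K) (C : Matrix μ' μ K)
    (t : ι → κ → μ → K) (a : ι') (b : κ') (c : μ') :
    actTensor A B C t a b c =
      ((A ⊗ₖ (B ⊗ₖ C)) *ᵥ fun p : ι × κ × μ => t p.1 p.2.1 p.2.2) (a, b, c) := by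
  simp only [actTensor, Matrix.mulVec, dotProduct, Fintype.sum_prod_type, Matrix.kronecker_apply,
    mul_assoc]

/-- **Composition law** of the action: `(A ⊗ B ⊗ C)·((A' ⊗ B' ⊗ C')·t) = (AA' ⊗ BB' ⊗ CC')·t`.
[folklore] -/
theorem actTensor_actTensor [Fintype ι'] [Fintype κ'] [Fintype μ'] (A : Matrix ι'' ι' K)
    (B : Matrix κ'' κ' K) (C : Matrix μ'' μ' K) (A' : Matrix ι' ι K) (B' : Matrix κ' κ K)
    (C' : Matrix μ' μ K) (t : ι → κ → μ → K) :
    actTensor A B C (actTensor A' B' C' t) = actTensor (A * A') (B * B') (C * C') t := by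
  funext a b c
  rw [actTensor_eq_kronecker_mulVec, actTensor_eq_kronecker_mulVec, Matrix.mul_kronecker_mul,
    Matrix.mul_kronecker_mul, ← Matrix.mulVec_mulVec]
  congr 2
  funext p
  exact actTensor_eq_kronecker_mulVec A' B' C' t p.1 p.2.1 p.2.2

end Action

section ActionTopology

variable {ι κ μ ι' κ' μ' : Type*} [Fintype ι] [Fintype κ] [Fintype μ]

/-- `t ↦ (A ⊗ B ⊗ C)·t` is continuous (it is linear on a finite-dimensional space). [folklore] -/
theorem continuous_actTensor (A : Matrix ι' ι ℂ) (B : Matrix κ' κ ℂ) (C : Matrix μ' μ ℂ) :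
    Continuous fun t : ι → κ → μ → ℂ => actTensor A B C t := by
  refine continuous_pi fun a => continuous_pi fun b => continuous_pi fun c => ?_
  simp only [actTensor]
  refine continuous_finsetSum _ fun a' _ => continuous_finsetSum _ fun b' _ =>
    continuous_finsetSum _ fun c' _ => continuous_const.mul ?_
  exact (continuous_apply c').comp ((continuous_apply b').comp (continuous_apply a'))

variable [DecidableEq ι] [DecidableEq κ] [DecidableEq μ]

/-- Invertible changes of bases do not kill a nonzero tensor. [folklore] -/
theorem actTensor_ne_zero_of_ne_zero {t : ι → κ → μ → ℂ} (ht : t ≠ 0)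
    (g : GL ι ℂ × GL κ ℂ × GL μ ℂ) :
    actTensor (g.1 : Matrix ι ι ℂ) (g.2.1 : Matrix κ κ ℂ) (g.2.2 : Matrix μ μ ℂ) t ≠ 0 := by
  intro h0
  apply ht
  have h : t = actTensor ((g.1⁻¹ : GL ι ℂ) : Matrix ι ι ℂ) ((g.2.1⁻¹ : GL κ ℂ) : Matrix κ κ ℂ)
      ((g.2.2⁻¹ : GL μ ℂ) : Matrix μ μ ℂ)
      (actTensor (g.1 : Matrix ι ι ℂ) (g.2.1 : Matrix κ κ ℂ) (g.2.2 : Matrix μ μ ℂ) t) := by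
    rw [actTensor_actTensor, Units.inv_mul, Units.inv_mul, Units.inv_mul, actTensor_one]
  rw [h, h0, actTensor_zero]

/-- Degeneration is stable under the group: `s ⊵ t ⇒ s ⊵ g·t` (the orbit closure is
`G`-invariant because `g` acts continuously and preserves the orbit).
[cite: ChristandlVranaZuiddam2023, Lemma 3.20 (proof)] -/
theorem TensorDegeneratesTo.actTensor_right {s t : ι → κ → μ → ℂ} (h : TensorDegeneratesTo s t)
    (g : GL ι ℂ × GL κ ℂ × GL μ ℂ) :
    TensorDegeneratesTo s
      (actTensor (g.1 : Matrix ι ι ℂ) (g.2.1 : Matrix κ κ ℂ) (g.2.2 : Matrix μ μ ℂ) t) := by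
  refine map_mem_closure (continuous_actTensor _ _ _) h ?_
  rintro _ ⟨g', rfl⟩
  refine ⟨g * g', ?_⟩
  simp only [Prod.fst_mul, Prod.snd_mul, Units.val_mul, actTensor_actTensor]

/-- The orbit closure of `0` is `{0}`: `0 ⊵ t ⇒ t = 0`. [folklore] -/
theorem TensorDegeneratesTo.eq_zero_of_zero {t : ι → κ → μ → ℂ}
    (h : TensorDegeneratesTo (0 : ι → κ → μ → ℂ) t) : t = 0 := by
  have hS : (Set.range fun g : GL ι ℂ × GL κ ℂ × GL μ ℂ =>
      actTensor (g.1 : Matrix ι ι ℂ) (g.2.1 : Matrix κ κ ℂ) (g.2.2 : Matrix μ μ ℂ)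
        (0 : ι → κ → μ → ℂ)) = {0} := by
    ext x
    simp only [actTensor_zero, Set.mem_range, exists_const, Set.mem_singleton_iff, eq_comm]
  rw [TensorDegeneratesTo, hS, closure_singleton, Set.mem_singleton_iff] at h
  exact h

end ActionTopology

/-! ## Power sums of eigenvalues are traces of powers -/

section Spectral

variable {n : Type*} [Fintype n] [DecidableEq n]

/-- `Tr(A^k) = ∑_i λ_i^k` for a Hermitian matrix `A` with eigenvalues `λ_i` (spectral theorem).
[folklore] -/
theorem trace_pow_eq_sum_eigenvalues_pow {A : Matrix n n ℂ} (hA : A.IsHermitian) (k : ℕ) :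
    (A ^ k).trace = ∑ i, ((hA.eigenvalues i : ℝ) : ℂ) ^ k := by
  conv_lhs => rw [hA.spectral_theorem, ← map_pow, Unitary.conjStarAlgAut_apply,
    Matrix.trace_mul_cycle, Unitary.coe_star_mul_self, one_mul, Matrix.diagonal_pow,
    Matrix.trace_diagonal]
  refine Finset.sum_congr rfl fun i _ => ?_
  simp only [Pi.pow_apply, Function.comp_apply]
  rfl

/-- Real form: `∑_i λ_i^k = Re Tr(A^k)`. [folklore] -/
theorem sum_eigenvalues_pow_eq_re_trace_pow {A : Matrix n n ℂ} (hA : A.IsHermitian) (k : ℕ) :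
    ∑ i, hA.eigenvalues i ^ k = ((A ^ k).trace).re := by
  rw [trace_pow_eq_sum_eigenvalues_pow hA k, Complex.re_sum]
  refine Finset.sum_congr rfl fun i _ => ?_
  rw [← Complex.ofReal_pow, Complex.ofReal_re]

/-- For a polynomial `p`, `∑_i p(λ_i(A)/c) = ∑_k p_k · Re Tr(A^k) / c^k`: a polynomial expression in
the entries of `A`. [folklore] -/
theorem sum_eval_eigenvalues_div_eq {A : Matrix n n ℂ} (hA : A.IsHermitian) (p : Polynomial ℝ)
    (c : ℝ) :
    ∑ i, p.eval (hA.eigenvalues i / c) =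
      ∑ k ∈ Finset.range (p.natDegree + 1), p.coeff k * (((A ^ k).trace).re / c ^ k) := by
  simp_rw [Polynomial.eval_eq_sum_range, div_pow]
  rw [Finset.sum_comm]
  refine Finset.sum_congr rfl fun k _ => ?_
  rw [← sum_eigenvalues_pow_eq_re_trace_pow hA k, Finset.sum_div, Finset.mul_sum]

end Spectral

/-! ## Continuity of the entropy of a normalised spectrum (Weierstrass) -/

section EntropyContinuity

variable {X : Type*} [TopologicalSpace X] {n : Type*} [Fintype n] [DecidableEq n]

/-- Let `M : X → Matrix n n ℂ` be continuous with Hermitian values, `T : X → ℝ` continuous and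
nonvanishing on `U`, and suppose the normalised eigenvalues `λ_i(M x)/T x` lie in `[0, 1]` on `U`.
Then `x ↦ ∑_i η(λ_i(M x)/T x)`, `η(y) = -y log y`, is continuous on `U`: it is the uniform limit on
`U` of the continuous functions `x ↦ ∑_i p(λ_i(M x)/T x) = ∑_k p_k Re Tr((M x)^k)/(T x)^k`, `p` a
polynomial approximating `η` on `[0, 1]` (Weierstrass). [folklore] -/
theorem continuousOn_sum_negMulLog_eigenvalues_div {M : X → Matrix n n ℂ}
    (hM : ∀ x, (M x).IsHermitian) {T : X → ℝ} {U : Set X} (hMc : Continuous M)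
    (hTc : Continuous T) (hT : ∀ x ∈ U, T x ≠ 0)
    (h01 : ∀ x ∈ U, ∀ i, (hM x).eigenvalues i / T x ∈ Set.Icc (0 : ℝ) 1) :
    ContinuousOn (fun x => ∑ i, negMulLog ((hM x).eigenvalues i / T x)) U := by
  apply continuousOn_of_uniform_approx_of_continuousOn
  intro u hu
  obtain ⟨ε, hε, hεu⟩ := Metric.mem_uniformity_dist.1 hu
  have hN : (0 : ℝ) < Fintype.card n + 1 := by positivity
  obtain ⟨p, hp⟩ := exists_polynomial_near_of_continuousOn 0 1 negMulLog
    Real.continuous_negMulLog.continuousOn (ε / (Fintype.card n + 1)) (div_pos hε hN)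
  refine ⟨fun x => ∑ i, p.eval ((hM x).eigenvalues i / T x), ?_, ?_⟩
  · -- the polynomial functional is continuous on `U`
    have heq : ∀ x, ∑ i, p.eval ((hM x).eigenvalues i / T x) =
        ∑ k ∈ Finset.range (p.natDegree + 1), p.coeff k * (((M x ^ k).trace).re / T x ^ k) :=
      fun x => sum_eval_eigenvalues_div_eq (hM x) p (T x)
    simp_rw [heq]
    refine continuousOn_finsetSum _ fun k _ => continuousOn_const.mul ?_
    refine ContinuousOn.div ?_ (hTc.pow k).continuousOn fun x hx => pow_ne_zero k (hT x hx)
    exact (Complex.continuous_re.comp (hMc.pow k).matrix_trace).continuousOn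
  · -- uniform closeness on `U`
    intro x hx
    apply hεu
    rw [dist_eq_norm, ← Finset.sum_sub_distrib]
    calc ‖∑ i, (negMulLog ((hM x).eigenvalues i / T x) - p.eval ((hM x).eigenvalues i / T x))‖
        ≤ ∑ i, ‖negMulLog ((hM x).eigenvalues i / T x) - p.eval ((hM x).eigenvalues i / T x)‖ :=
          norm_sum_le _ _
      _ ≤ ∑ _i : n, ε / (Fintype.card n + 1) := by
          refine Finset.sum_le_sum fun i _ => ?_
          rw [Real.norm_eq_abs, abs_sub_comm]
          exact (hp _ (h01 x hx i)).le
      _ = ε * (Fintype.card n / (Fintype.card n + 1)) := by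
          rw [Finset.sum_const, Finset.card_univ, nsmul_eq_mul]
          ring
      _ < ε * 1 := by
          refine mul_lt_mul_of_pos_left ?_ hε
          rw [div_lt_one hN]
          exact lt_add_one _
      _ = ε := mul_one ε

end EntropyContinuity

/-! ## Continuity of `H_θ` on nonzero tensors -/

section QuantumEntropyContinuity

variable {ι κ μ : Type*} [Fintype ι] [Fintype κ] [Fintype μ]

/-- `t ↦ ⟨t|t⟩` is continuous. [folklore] -/
theorem continuous_tensorNormSq : Continuous (tensorNormSq : (ι → κ → μ → ℂ) → ℝ) := by
  unfold tensorNormSq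
  fun_prop

/-- `⟨t|t⟩ > 0` for `t ≠ 0`. [folklore] -/
theorem tensorNormSq_pos {t : ι → κ → μ → ℂ} (ht : t ≠ 0) : 0 < tensorNormSq t :=
  (tensorNormSq_nonneg t).lt_of_ne' (mt (tensorNormSq_eq_zero_iff t).1 ht)

omit [Fintype ι] [Fintype κ] [Fintype μ] in
/-- The flattenings are continuous (coordinate projections). [folklore] -/
theorem continuous_flatten₁ : Continuous (flatten₁ : (ι → κ → μ → ℂ) → Matrix ι (κ × μ) ℂ) :=
  continuous_matrix fun a p =>
    (continuous_apply p.2).comp ((continuous_apply p.1).comp (continuous_apply a))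

omit [Fintype ι] [Fintype κ] [Fintype μ] in
/-- The flattenings are continuous (coordinate projections). [folklore] -/
theorem continuous_flatten₂ : Continuous (flatten₂ : (ι → κ → μ → ℂ) → Matrix κ (ι × μ) ℂ) :=
  continuous_matrix fun b p =>
    (continuous_apply p.2).comp ((continuous_apply b).comp (continuous_apply p.1))

omit [Fintype ι] [Fintype κ] [Fintype μ] in
/-- The flattenings are continuous (coordinate projections). [folklore] -/
theorem continuous_flatten₃ : Continuous (flatten₃ : (ι → κ → μ → ℂ) → Matrix μ (ι × κ) ℂ) :=
  continuous_matrix fun c p =>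
    (continuous_apply c).comp ((continuous_apply p.2).comp (continuous_apply p.1))

omit [Fintype ι] in
/-- The quantum marginals `|t⟩⟨t|ⱼ` are continuous in `t` (quadratic in the entries). [folklore] -/
theorem continuous_reducedDensity₁ :
    Continuous (reducedDensity₁ : (ι → κ → μ → ℂ) → Matrix ι ι ℂ) :=
  continuous_flatten₁.matrix_mul continuous_flatten₁.matrix_conjTranspose

omit [Fintype κ] in
/-- The quantum marginals `|t⟩⟨t|ⱼ` are continuous in `t` (quadratic in the entries). [folklore] -/
theorem continuous_reducedDensity₂ :
    Continuous (reducedDensity₂ : (ι → κ → μ → ℂ) → Matrix κ κ ℂ) :=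
  continuous_flatten₂.matrix_mul continuous_flatten₂.matrix_conjTranspose

omit [Fintype μ] in
/-- The quantum marginals `|t⟩⟨t|ⱼ` are continuous in `t` (quadratic in the entries). [folklore] -/
theorem continuous_reducedDensity₃ :
    Continuous (reducedDensity₃ : (ι → κ → μ → ℂ) → Matrix μ μ ℂ) :=
  continuous_flatten₃.matrix_mul continuous_flatten₃.matrix_conjTranspose

variable [DecidableEq ι] [DecidableEq κ] [DecidableEq μ]

omit [DecidableEq κ] [DecidableEq μ] in
/-- `t ↦ H(r₁(t))` is continuous on nonzero tensors. [cite: ChristandlVranaZuiddam2023, Lemma 3.20 (proof)] -/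
theorem continuousOn_shannonEntropy_marginalSpectrum₁ :
    ContinuousOn (fun t : ι → κ → μ → ℂ => shannonEntropy (marginalSpectrum₁ t)) {t | t ≠ 0} := by
  have h := continuousOn_sum_negMulLog_eigenvalues_div (fun t => isHermitian_reducedDensity₁ t)
    (U := {t : ι → κ → μ → ℂ | t ≠ 0}) continuous_reducedDensity₁ continuous_tensorNormSq
    (fun t ht => (tensorNormSq_pos ht).ne')
    (fun t ht i => ⟨(marginalSpectrum₁_mem_stdSimplex ht).1 i,
      le_one_of_mem_stdSimplex (marginalSpectrum₁_mem_stdSimplex ht) i⟩)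
  exact h.div_const (Real.log 2)

omit [DecidableEq ι] [DecidableEq μ] in
/-- `t ↦ H(r₂(t))` is continuous on nonzero tensors. [cite: ChristandlVranaZuiddam2023, Lemma 3.20 (proof)] -/
theorem continuousOn_shannonEntropy_marginalSpectrum₂ :
    ContinuousOn (fun t : ι → κ → μ → ℂ => shannonEntropy (marginalSpectrum₂ t)) {t | t ≠ 0} := by
  have h := continuousOn_sum_negMulLog_eigenvalues_div (fun t => isHermitian_reducedDensity₂ t)
    (U := {t : ι → κ → μ → ℂ | t ≠ 0}) continuous_reducedDensity₂ continuous_tensorNormSq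
    (fun t ht => (tensorNormSq_pos ht).ne')
    (fun t ht i => ⟨(marginalSpectrum₂_mem_stdSimplex ht).1 i,
      le_one_of_mem_stdSimplex (marginalSpectrum₂_mem_stdSimplex ht) i⟩)
  exact h.div_const (Real.log 2)

omit [DecidableEq ι] [DecidableEq κ] in
/-- `t ↦ H(r₃(t))` is continuous on nonzero tensors. [cite: ChristandlVranaZuiddam2023, Lemma 3.20 (proof)] -/
theorem continuousOn_shannonEntropy_marginalSpectrum₃ :
    ContinuousOn (fun t : ι → κ → μ → ℂ => shannonEntropy (marginalSpectrum₃ t)) {t | t ≠ 0} := by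
  have h := continuousOn_sum_negMulLog_eigenvalues_div (fun t => isHermitian_reducedDensity₃ t)
    (U := {t : ι → κ → μ → ℂ | t ≠ 0}) continuous_reducedDensity₃ continuous_tensorNormSq
    (fun t ht => (tensorNormSq_pos ht).ne')
    (fun t ht i => ⟨(marginalSpectrum₃_mem_stdSimplex ht).1 i,
      le_one_of_mem_stdSimplex (marginalSpectrum₃_mem_stdSimplex ht) i⟩)
  exact h.div_const (Real.log 2)

/-- **Continuity of `H_θ`** on nonzero tensors (the analytic input of CVZ Lemma 3.20).
[cite: ChristandlVranaZuiddam2023, Lemma 3.20 (proof)] -/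
theorem continuousOn_quantumEntropy (θ : Fin 3 → ℝ) :
    ContinuousOn (quantumEntropy θ : (ι → κ → μ → ℂ) → ℝ) {t | t ≠ 0} :=
  ((continuousOn_const.mul continuousOn_shannonEntropy_marginalSpectrum₁).add
    (continuousOn_const.mul continuousOn_shannonEntropy_marginalSpectrum₂)).add
    (continuousOn_const.mul continuousOn_shannonEntropy_marginalSpectrum₃)

end QuantumEntropyContinuity

/-! ## CVZ Lemma 3.20 and the discharge of `ChristandlVranaZuiddam2023_degeneration_mono` -/

section DegenerationMono

variable {ι κ μ : Type*} [Fintype ι] [Fintype κ] [Fintype μ] [DecidableEq ι] [DecidableEq κ]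
  [DecidableEq μ]

/-- The displayed inequality of CVZ Lemma 3.20: if `s ⊵ t` and `t ≠ 0` then `H_θ(t) ≤ E_θ(s)`
(`H_θ` is continuous at `t`, bounded by `E_θ(s)` on the orbit of `s`, and `t` is in its closure).
[cite: ChristandlVranaZuiddam2023, Lemma 3.20] -/
theorem quantumEntropy_le_logQuantumFunctional_of_degeneratesTo {θ : Fin 3 → ℝ}
    (hθ : ∀ i, 0 ≤ θ i) {s t : ι → κ → μ → ℂ} (ht : t ≠ 0) (hst : TensorDegeneratesTo s t) :
    quantumEntropy θ t ≤ logQuantumFunctional θ s := by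
  set S : Set (ι → κ → μ → ℂ) := Set.range fun g : GL ι ℂ × GL κ ℂ × GL μ ℂ =>
    actTensor (g.1 : Matrix ι ι ℂ) (g.2.1 : Matrix κ κ ℂ) (g.2.2 : Matrix μ μ ℂ) s with hS
  have hmemS : t ∈ closure S := hst
  have hcont : ContinuousWithinAt (quantumEntropy θ) S t :=
    ((continuousOn_quantumEntropy θ).continuousAt (isOpen_ne.mem_nhds ht)).continuousWithinAt
  have hmem : quantumEntropy θ t ∈ closure (quantumEntropy θ '' S) := hcont.mem_closure_image hmemS
  have hsub : quantumEntropy θ '' S ⊆ Set.Iic (logQuantumFunctional θ s) := by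
    rintro _ ⟨_, ⟨g, rfl⟩, rfl⟩
    exact quantumEntropy_actTensor_le_logQuantumFunctional hθ s g
  exact closure_minimal hsub isClosed_Iic hmem

/-- **CVZ Lemma 3.20, logarithmic form**: if `s ⊵ t` and `t ≠ 0` then `E_θ(t) ≤ E_θ(s)`
(apply the previous inequality to `g·t`, which is again a nonzero degeneration of `s`, and take
the supremum over `g`). [cite: ChristandlVranaZuiddam2023, Lemma 3.20] -/
theorem logQuantumFunctional_le_of_degeneratesTo {θ : Fin 3 → ℝ} (hθ : ∀ i, 0 ≤ θ i)
    {s t : ι → κ → μ → ℂ} (ht : t ≠ 0) (hst : TensorDegeneratesTo s t) :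
    logQuantumFunctional θ t ≤ logQuantumFunctional θ s :=
  ciSup_le fun g => quantumEntropy_le_logQuantumFunctional_of_degeneratesTo hθ
    (actTensor_ne_zero_of_ne_zero ht g) (hst.actTensor_right g)

/-- **CVZ Thm. 3.19.4 = Lemma 3.20 for one format**: `s ⊵ t ⇒ F^θ(t) ≤ F^θ(s)` for `θ ≥ 0`.
[cite: ChristandlVranaZuiddam2023, Thm. 3.19.4] -/
theorem quantumFunctional_le_of_degeneratesTo {θ : Fin 3 → ℝ} (hθ : ∀ i, 0 ≤ θ i)
    {s t : ι → κ → μ → ℂ} (hst : TensorDegeneratesTo s t) :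
    quantumFunctional θ t ≤ quantumFunctional θ s := by
  by_cases ht : t = 0
  · subst ht
    rw [quantumFunctional_zero]
    exact quantumFunctional_nonneg θ s
  · have hs : s ≠ 0 := by
      rintro rfl
      exact ht hst.eq_zero_of_zero
    rw [quantumFunctional_of_ne_zero θ ht, quantumFunctional_of_ne_zero θ hs]
    exact Real.rpow_le_rpow_of_exponent_le one_le_two
      (logQuantumFunctional_le_of_degeneratesTo hθ ht hst)

end DegenerationMono

/-- **Discharge of the named fact `ChristandlVranaZuiddam2023_degeneration_mono`** (CVZ
Thm. 3.19.4 = Lemma 3.20, case `k = 3`): for every `θ ∈ P([3])` and complex 3-tensors `s ⊵ t` of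
the same format, `F^θ(t) ≤ F^θ(s)`. [cite: ChristandlVranaZuiddam2023, Thm. 3.19.4] -/
theorem ChristandlVranaZuiddam2023_degeneration_mono_holds :
    ChristandlVranaZuiddam2023_degeneration_mono.{u} :=
  fun _θ hθ _ι _κ _μ _ _ _ _ _ _ _s _t hst => quantumFunctional_le_of_degeneratesTo hθ.1 hst

end Literature.Computability.AlgebraicComplexity

end
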